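import Literature.NumberTheory.NumberFields.NFIsoMemP
import HarnessLib

/-!
# Discharge of `lenstra_numberFieldIso_mem_P` (number-field isomorphism is in `P`)

Sibling proofs file of `NumberFieldIsomorphism.lean` (named facts `lll_monicIrreducible_mem_P`,
`lenstra_numberFieldIso_mem_P`). The fact `lenstra_numberFieldIso_mem_P : NFIsoLang ∈ Classes.P`
(A. K. Lenstra 1983, Thm. (3.7); Landau 1985, Thm. 2.1 and Cor.; H. W. Lenstra 1992, §2.9) is the
decode-based twin of `Literature.NumberTheory.NumberFields.nfIso_mem_P` (exact codes); both are
decided by the same polynomial-time machine, assembled and proved correct in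
`Literature/NumberTheory/NumberFields/NFIso*.lean` (parsing and the LLL irreducibility test,
degree check, Trager's norm by integer resultants and exact interpolation, multiplier search,
complete factorisation modulo a small prime, Hensel lifting, and the LLL degree test, over the
tree's `IrreducibilityLLL*.lean` bricks and LLL machine): `NFIsoMemP.nfIsoLangDecoded_mem_P`.
This file records the discharge under the fact's own name.

## References

* A. K. Lenstra, *Factoring polynomials over algebraic number fields*, EUROCAL '83, LNCS 162
  (1983) 245–254, Thm. (3.7). [Lenstra1983]
* S. Landau, *Factoring polynomials over algebraic number fields*, SIAM J. Comput. 14 (1985)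
  184–195, §2 (Thm. 2.1 and Cor.). [Landau1985]
* H. Cohen, *A Course in Computational Algebraic Number Theory*, GTM 138, 1993, Prop. 4.5.3,
  Alg. 4.5.4, §4.5.4. [Cohen1993]
-/

namespace Literature.Computability.Complexity

/-- **Discharge of the named fact `lenstra_numberFieldIso_mem_P`: the language `NFISO` of pairs of
codes of monic irreducible integer polynomials defining `ℚ`-isomorphic number fields is in `P`**
(A. K. Lenstra 1983, Thm. (3.7); Landau 1985; Cohen Prop. 4.5.3 / Alg. 4.5.4), by the machine of
`Literature.NumberTheory.NumberFields.NFIsoMemP` (`nfIsoLangDecoded_mem_P`).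
[cite: Lenstra1983, Thm. 3.7] [cite: Landau1985, §2 (Thm. 2.1 and Cor.)] [cite: Cohen1993, Prop. 4.5.3, Alg. 4.5.4 and §4.5.4 (PDF pp. 230–232)] -/
theorem lenstra_numberFieldIso_mem_P_holds : lenstra_numberFieldIso_mem_P :=
  Literature.NumberTheory.NumberFields.nfIsoLangDecoded_mem_P

end Literature.Computability.Complexity
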